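import Summits.HodgeConjecture.CorCM.OcticWeilOrbitFrameTransfer
import Summits.HodgeConjecture.CorCM.OcticWeilFourfoldWeilParts
import Summits.HodgeConjecture.CorCM.QuadraticCMTypeSlice
import HarnessLib

/-!
# COR-CM — the Galois orbit of a simple CM fourfold of Weil type (`E × B₁ × B₂ × B₃`, octic `F ⊇ k`): the WEIL PARTS of
# the weights of every product of copies have algebraic lines, GIVEN Markman's fourfold theorem

Cell `pub-hodgecm2` (COR-CM), seat b30 gen 20 (2026-08-22); count-neutral own lane OCTIC-WEIL-ORBIT, sequel of
`CorCM/OcticWeilOrbitFrameTransfer.lean` (slot map `orbitSlots`, model map `toPt₃`).  Theorems only; no definition, no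
`sorry`; the ONE named fact is DISPLAYED as a hypothesis: `Markman2025_weilClasses_algebraic_abelianFourfold` (Markman 2025,
unrefereed — every rational class in `W_k ⊗ ℂ ⊕ W̄` of an abelian FOURFOLD of Weil type is algebraic).

SETTING as in the frame-transfer file: `k = Kf i₀` quadratic, `F = Kf i₁` octic, `i : k → F`, four slots `(k, F, F, F)`,
`A₄ 0 = E ⊨ (k; {τ})`, `A₄ (m+1) = B_m ⊨ (F; Φ_{I_m})` read in a frame `e` (`hΦ`), `X = ⨁_j A₄(κ j)` for a slot map
`κ : Fin N → Fin 4`.  A WEIL PART of type `m` and sign `b` of a configuration of `X` (`Census.OcticWeilOrbit.IsWeil₃Part`) is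
a `4`-set with exactly one point over each label `(m, a, b)`, `a < 4` — the four embeddings of `F` over `τ_b`
(`τ_true = τ`, `τ_false = τ̄`) on copies of `B_m`, possibly SPREAD over up to four copies.

* §1 `typeCount_eq_two_of_frame₃` — each `Φ_{I_m}` has exactly two members over each embedding of `k` (`k`-signature
  `(2,2)`: every `B_m` is an abelian fourfold of Weil type for `k`).
* §2 `weilWeight_mem_pohlmannSetsAlg₃` — the Weil weight `{(0, s) | s ∘ i = τ₁}` of the ONE-slot product `⨁_{Fin 1} B_m`
  is `Aut(ℂ)`-balanced from the type count alone (gen 19's fibre lemmas BY NAME); hence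
  `weightClassesAlg_weilWeight_le_algebraicClasses_of_markman₃` (dimension `4` + the cell's
  `CMWeights.weightClassesAlg_le_algebraicClasses_two_of_markman`) and, pulled back to `Y = ⨁ A₄` along the slot inclusion
  `Fin 1 → Fin 4`, `weightClassesAlg_weilWeight₄_le_algebraicClasses_of_markman`.
* §3 **`weightClassesAlg_le_algebraicClasses_of_isWeil₃Part`** — a Weil part of a weight of `X` has an algebraic line: its
  slot projection is injective with image the Weil weight of `Y` in slot `m+1` over `τ_b`; seat b30's distribution lemma
  (`CMWeights.weightClassesAlg_comp_le_algebraicClasses_of_injOn`) lifts algebraicity along `κ`.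
HONEST FRAMING: conditional on the displayed Markman binder; `HC_CM` is not asserted.
[cite: Markman2025SurveySecant, Thm. 1.2 and §1.1] [cite: MoonenZarhin1995Duke, Thm. 2.4] [cite: Deligne1982HodgeCycles, §4 Prop. 4.4]
[cite: Milne2020HodgeClassesAV, 1.2 (a) and Thm. 1]

## References
* [Markman2025SurveySecant] E. Markman, arXiv:2509.23403 (2025), Thm. 1.2, §1.1 (fourfolds of Weil type; unrefereed).
* [MoonenZarhin1999LowDim] B. Moonen, Yu. Zarhin, Math. Ann. 315 (1999), Thm. 0.2, (2.8).
* [Milne2020HodgeClassesAV] J. S. Milne, arXiv:2010.08857, 1.2 (a), Thm. 1.  [Deligne1982HodgeCycles] P. Deligne, LNM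
  900 (1982), §4 Prop. 4.4.  [MoonenZarhin1995Duke] B. Moonen, Yu. Zarhin, Duke Math. J. 77 (1995), Thm. 2.4.
-/

noncomputable section

open CategoryTheory CategoryTheory.Limits NumberField

namespace Summit.HodgeConjecture.CorCM.OcticWeilOrbit

open Literature.AlgebraicGeometry Literature.AlgebraicGeometry.Motives Literature.AlgebraicGeometry.HodgeTheory
open Literature.AlgebraicGeometry.ComplexMultiplication (IsCMTypeRealisation)
open Literature.AlgebraicGeometry.Pohlmann1968
open Literature.AlgebraicTopology.SingularHomology
open Literature.NumberTheory.ComplexMultiplication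
open Summit.HodgeConjecture.CorCM.Census.OcticWeilOrbit (Pt₃ signTab IsWeil₃Part)
open Summit.HodgeConjecture.CorCM.OcticCurveFourfold (comp_injective comp_eq_conjugate_of_snd_eq_false card_filter_comp_eq_four)
open Summit.HodgeConjecture.CorCM.OcticWeilFourfold (card_filter_comp_eq_and_comp_mem_eq snd_eq_iff_comp_eq)
open Summit.HodgeConjecture.CorCM.CMWeights (weightClassesAlg_comp_le_algebraicClasses_of_injOn
  weightClassesAlg_map_le_algebraicClasses weightClassesAlg_le_algebraicClasses_two_of_markman sum_finrank_eq_two_mul_dim)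
open Summit.HodgeConjecture.CorCM.DihedralSexticPairCurvePowers (ncard_sep_eq_card_filter)
open Summit.HodgeConjecture.CorCM.DihedralSexticPair (card_filter_equiv_mem)

open scoped Classical Pointwise

/-! ## §1 The type count `(2, 2)` of each `Φ_{I_m}`, read off the frame -/

section TypeCount

variable {I : Type} {Kf : I → Type} [∀ i, Field (Kf i)] [∀ i, NumberField (Kf i)] [∀ i, IsCMField (Kf i)] {i₀ i₁ : I}
  {e : (Kf i₁ →+* ℂ) ≃ Fin 4 × Bool} {τ : Kf i₀ →+* ℂ} {i : Kf i₀ →+* Kf i₁}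

/-- The finite facts: for each `m < 3`, exactly two labels `(a, true)` and two labels `(a, false)` satisfy
`c = signTab 0 m a` (`I_m = {0, m+1}` and its complement both have two elements). [folklore] -/
theorem card_signTab_sign (m : Fin 3) (b : Bool) :
    ((Finset.univ : Finset (Fin 4 × Bool)).filter fun p => p.2 = b ∧ p.2 = signTab 0 m p.1).card = 2 := by
  revert m b; decide

/-- **The type count read off the frame**: for `s ∈ Φ ⟺ (e s).2 = signTab 0 m (e s).1` and `(e s).2 = [s ∘ i = τ]`, every
complex embedding `τ'` of `k` has `#{s ∈ Φ : s ∘ i = τ'} = 2` — `k`-signature `(2,2)`, `B_m` is an abelian fourfold of Weil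
type for `k`. [cite: Deligne1982HodgeCycles, §4 Prop. 4.4] [cite: MoonenZarhin1995Duke, Thm. 2.4] -/
theorem typeCount_eq_two_of_frame₃ (h2 : Module.finrank ℚ (Kf i₀) = 2)
    (he_sign : ∀ s : Kf i₁ →+* ℂ, (e s).2 = true ↔ s.comp i = τ) (m : Fin 3)
    {Φ : CMType (Kf i₁)} (hΦ : ∀ s : Kf i₁ →+* ℂ, s ∈ Φ.1 ↔ (e s).2 = signTab 0 m (e s).1) (τ' : Kf i₀ →+* ℂ) :
    (Finset.univ.filter fun s : Kf i₁ →+* ℂ => s.comp i = τ' ∧ s ∈ Φ.1).card = 2 := by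
  have hττ : ComplexEmbedding.conjugate τ ≠ τ := QuarticCM.conjugate_ne τ
  have hk : ∀ σ : Kf i₀ →+* ℂ, σ = τ ∨ σ = ComplexEmbedding.conjugate τ := fun σ =>
    QuarticCM.eq_or_eq_conjugate_of_quadratic h2 τ σ
  -- over `τ'` the sign is the constant `b = [τ' = τ]`
  obtain ⟨b, hb⟩ : ∃ b : Bool, ∀ s : Kf i₁ →+* ℂ, s.comp i = τ' ↔ (e s).2 = b := by
    rcases hk τ' with rfl | rfl
    · exact ⟨true, fun s => (he_sign s).symm⟩
    · refine ⟨false, fun s => ⟨fun h => ?_, fun h => comp_eq_conjugate_of_snd_eq_false hk he_sign h⟩⟩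
      cases hs : (e s).2
      · rfl
      · exact absurd (((he_sign s).1 hs).symm.trans h) hττ.symm
  have hfilter : (Finset.univ.filter fun s : Kf i₁ →+* ℂ => s.comp i = τ' ∧ s ∈ Φ.1) =
      Finset.univ.filter fun s => e s ∈
        ((Finset.univ : Finset (Fin 4 × Bool)).filter fun p => p.2 = b ∧ p.2 = signTab 0 m p.1) := by
    refine Finset.filter_congr fun s _ => ?_
    rw [hb s, hΦ s, Finset.mem_filter]
    exact ⟨fun h => ⟨Finset.mem_univ _, h⟩, fun h => h.2⟩
  rw [hfilter, card_filter_equiv_mem, card_signTab_sign]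

end TypeCount

/-! ## §2 The Weil weight of the one-slot product `⨁_{Fin 1} B_m` is balanced and algebraic given Markman -/

section Markman

variable {I : Type} {Kf : I → Type} [∀ i, Field (Kf i)] [∀ i, NumberField (Kf i)] [∀ i, IsCMField (Kf i)]
  {i₀ i₁ : I} (i : Kf i₀ →+* Kf i₁) (m : Fin 3)
  {A₄ : Fin 4 → AbelianVariety ℂ} {Φ₄ : ∀ j : Fin 4, CMType (Kf (orbitSlots i₀ i₁ j))}
  {ι₄ : ∀ j, 𝓞 (Kf (orbitSlots i₀ i₁ j)) →+* End (A₄ j)}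
  {θ₄ : ∀ j, Kf (orbitSlots i₀ i₁ j) →+* Module.End ℂ (complexBetti (A₄ j).X 1)}

omit [∀ i, NumberField (Kf i)] [∀ i, IsCMField (Kf i)] in
/-- The index map `s ↦ (0, s)` into the index set of the one-slot product `⨁_{Fin 1} B_m` is injective. [folklore] -/
theorem sigmaMk_one_injective₃ : Function.Injective fun s : Kf i₁ →+* ℂ =>
    (⟨(0 : Fin 1), s⟩ : (j : Fin 1) × (Kf (orbitSlots i₀ i₁ ((fun _ : Fin 1 => m.succ) j)) →+* ℂ)) :=
  fun s s' h => by cases h; rfl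

omit [∀ i, NumberField (Kf i)] [∀ i, IsCMField (Kf i)] in
/-- The index map `s ↦ (m+1, s)` into the index set of `Y = E ⊞ B₁ ⊞ B₂ ⊞ B₃` is injective. [folklore] -/
theorem sigmaMk_succ_injective₃ : Function.Injective fun s : Kf i₁ →+* ℂ =>
    (⟨m.succ, s⟩ : (l : Fin 4) × (Kf (orbitSlots i₀ i₁ l) →+* ℂ)) :=
  fun s s' h => by cases h; rfl

omit [∀ i, IsCMField (Kf i)] in
/-- **THE WEIL WEIGHT of the one-slot product `⨁_{Fin 1} B_m` is `Aut(ℂ)`-balanced**: the weight `{(0, s) | s ∘ i = τ₁}`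
(of the Weil line `⋀⁴ H¹(B_m)_{τ₁} ⊆ W_k(B_m) ⊗ ℂ`) lies in `pohlmannSetsAlg _ 2`, from the TYPE COUNT
`#{s ∈ Φ_{I_m} | s ∘ i = τ'} = 2` alone — no Galois hypothesis. [cite: Deligne1982HodgeCycles, §4 Prop. 4.4]
[cite: MoonenZarhin1995Duke, Thm. 2.4] -/
theorem weilWeight_mem_pohlmannSetsAlg₃ (h8 : Module.finrank ℚ (Kf i₁) = 8) (h2 : Module.finrank ℚ (Kf i₀) = 2)
    (hcount : ∀ τ' : Kf i₀ →+* ℂ,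
      (Finset.univ.filter fun s : Kf i₁ →+* ℂ => s.comp i = τ' ∧ s ∈ (Φ₄ m.succ).1).card = 2)
    (τ₁ : Kf i₀ →+* ℂ) :
    ((Finset.univ.filter fun s : Kf i₁ →+* ℂ => s.comp i = τ₁).image fun s : Kf i₁ →+* ℂ =>
        (⟨(0 : Fin 1), s⟩ : (j : Fin 1) × (Kf (orbitSlots i₀ i₁ ((fun _ : Fin 1 => m.succ) j)) →+* ℂ))) ∈
      pohlmannSetsAlg (K := fun j : Fin 1 => Kf (orbitSlots i₀ i₁ ((fun _ : Fin 1 => m.succ) j)))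
        (fun j => Φ₄ ((fun _ : Fin 1 => m.succ) j)) 2 := by
  have h4 : ∀ τ' : Kf i₀ →+* ℂ, (Finset.univ.filter fun s : Kf i₁ →+* ℂ => s.comp i = τ').card = 4 :=
    card_filter_comp_eq_four i h8 h2
  have hci := Finset.card_image_of_injective (Finset.univ.filter fun s : Kf i₁ →+* ℂ => s.comp i = τ₁)
    (sigmaMk_one_injective₃ (i₀ := i₀) (i₁ := i₁) m)
  refine ⟨by rw [hci, h4 τ₁], fun ρ => ?_⟩
  rw [ncard_sep_eq_card_filter, ncard_sep_eq_card_filter, Finset.filter_image, Finset.filter_image,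
    Finset.card_image_of_injective _ (sigmaMk_one_injective₃ (i₀ := i₀) (i₁ := i₁) m),
    Finset.card_image_of_injective _ (sigmaMk_one_injective₃ (i₀ := i₀) (i₁ := i₁) m), Finset.filter_filter,
    Finset.filter_filter]
  obtain ⟨hin, hout⟩ := card_filter_comp_eq_and_comp_mem_eq i (Φ₄ m.succ).1 h4 hcount ρ τ₁
  exact hin.trans hout.symm

variable (hA : ∀ j, IsCMTypeRealisation (Φ₄ j) (A₄ j) (ι₄ j) (θ₄ j))

include hA in
omit [∀ i, IsCMField (Kf i)] in
/-- The one-slot product `⨁_{Fin 1} B_m` has dimension `4` (`[F:ℚ] = 8`). [folklore] -/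
theorem dim_biproduct_one_eq_four₃ (h8 : Module.finrank ℚ (Kf i₁) = 8) :
    (⨁ fun j : Fin 1 => A₄ ((fun _ : Fin 1 => m.succ) j)).dim = 4 := by
  have h := sum_finrank_eq_two_mul_dim (K := fun j : Fin 1 => Kf (orbitSlots i₀ i₁ ((fun _ : Fin 1 => m.succ) j)))
    (fun j => hA ((fun _ : Fin 1 => m.succ) j))
  rw [Fin.sum_univ_one] at h
  change Module.finrank ℚ (Kf i₁) = _ at h
  omega

include hA in
/-- **The Weil weight of `⨁_{Fin 1} B_m` has an algebraic line, GIVEN Markman's theorem**: dimension `4` and balanced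
(`weilWeight_mem_pohlmannSetsAlg₃`), so the cell's `CMWeights.weightClassesAlg_le_algebraicClasses_two_of_markman` applies
(a balanced `4`-set of a CM-product fourfold indexes a divisor monomial or is a Weil section; here the Weil line
`⋀⁴ H¹(B_m)_{τ₁}` of `W_k(B_m) ⊗ ℂ`). [cite: Markman2025SurveySecant, Thm. 1.2 and §1.1] [cite: MoonenZarhin1995Duke, Thm. 2.4] -/
theorem weightClassesAlg_weilWeight_le_algebraicClasses_of_markman₃
    (hW4 : Markman2025_weilClasses_algebraic_abelianFourfold)
    (h8 : Module.finrank ℚ (Kf i₁) = 8) (h2 : Module.finrank ℚ (Kf i₀) = 2)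
    (hcount : ∀ τ' : Kf i₀ →+* ℂ,
      (Finset.univ.filter fun s : Kf i₁ →+* ℂ => s.comp i = τ' ∧ s ∈ (Φ₄ m.succ).1).card = 2)
    (τ₁ : Kf i₀ →+* ℂ) :
    weightClassesAlg (fun j : Fin 1 => A₄ ((fun _ : Fin 1 => m.succ) j))
        (fun j => ι₄ ((fun _ : Fin 1 => m.succ) j)) (2 * 2)
        ((Finset.univ.filter fun s : Kf i₁ →+* ℂ => s.comp i = τ₁).image fun s : Kf i₁ →+* ℂ =>
          (⟨(0 : Fin 1), s⟩ : (j : Fin 1) × (Kf (orbitSlots i₀ i₁ ((fun _ : Fin 1 => m.succ) j)) →+* ℂ))) ≤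
      algebraicClasses (⨁ fun j : Fin 1 => A₄ ((fun _ : Fin 1 => m.succ) j)).X 2 :=
  weightClassesAlg_le_algebraicClasses_two_of_markman hW4 (fun j => hA ((fun _ : Fin 1 => m.succ) j))
    (dim_biproduct_one_eq_four₃ m hA h8) (weilWeight_mem_pohlmannSetsAlg₃ i m h8 h2 hcount τ₁)

include hA in
/-- **… and so does the Weil weight `{(m+1, s) | s ∘ i = τ₁}` of `Y = E ⊞ B₁ ⊞ B₂ ⊞ B₃`** (pull-back along the projection
`Y → ⨁_{Fin 1} B_m`: `CMWeights.weightClassesAlg_map_le_algebraicClasses`). [cite: MoonenZarhin1999LowDim, Thm. 0.2 and (2.8)]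
[cite: Markman2025SurveySecant, Thm. 1.2] -/
theorem weightClassesAlg_weilWeight₄_le_algebraicClasses_of_markman
    (hW4 : Markman2025_weilClasses_algebraic_abelianFourfold)
    (h8 : Module.finrank ℚ (Kf i₁) = 8) (h2 : Module.finrank ℚ (Kf i₀) = 2)
    (hcount : ∀ τ' : Kf i₀ →+* ℂ,
      (Finset.univ.filter fun s : Kf i₁ →+* ℂ => s.comp i = τ' ∧ s ∈ (Φ₄ m.succ).1).card = 2)
    (τ₁ : Kf i₀ →+* ℂ) :
    weightClassesAlg A₄ ι₄ (2 * 2)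
        ((Finset.univ.filter fun s : Kf i₁ →+* ℂ => s.comp i = τ₁).image fun s : Kf i₁ →+* ℂ =>
          (⟨m.succ, s⟩ : (l : Fin 4) × (Kf (orbitSlots i₀ i₁ l) →+* ℂ))) ≤
      algebraicClasses (⨁ A₄).X 2 := by
  have he : Function.Injective (fun _ : Fin 1 => m.succ) := fun a b _ => Subsingleton.elim a b
  have hS''card : ((Finset.univ.filter fun s : Kf i₁ →+* ℂ => s.comp i = τ₁).image fun s : Kf i₁ →+* ℂ =>
      (⟨(0 : Fin 1), s⟩ : (j : Fin 1) × (Kf (orbitSlots i₀ i₁ ((fun _ : Fin 1 => m.succ) j)) →+* ℂ))).card =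
      2 * 2 := by
    rw [Finset.card_image_of_injective _ (sigmaMk_one_injective₃ (i₀ := i₀) (i₁ := i₁) m),
      card_filter_comp_eq_four i h8 h2 τ₁]
  have h := weightClassesAlg_map_le_algebraicClasses hA (fun _ : Fin 1 => m.succ) he hS''card
    (weightClassesAlg_weilWeight_le_algebraicClasses_of_markman₃ i m hA hW4 h8 h2 hcount τ₁)
  rw [Finset.map_eq_image, Finset.image_image] at h
  exact h

end Markman

/-! ## §3 Weil parts of the products of copies have algebraic lines -/

section Parts

variable {I : Type} {Kf : I → Type} [∀ i, Field (Kf i)] [∀ i, NumberField (Kf i)] [∀ i, IsCMField (Kf i)]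
  {i₀ i₁ : I} {N : ℕ} (κ : Fin N → Fin 4) {e : (Kf i₁ →+* ℂ) ≃ Fin 4 × Bool} {τ : Kf i₀ →+* ℂ} {i : Kf i₀ →+* Kf i₁}
  {A₄ : Fin 4 → AbelianVariety ℂ} {Φ₄ : ∀ j : Fin 4, CMType (Kf (orbitSlots i₀ i₁ j))}
  {ι₄ : ∀ j, 𝓞 (Kf (orbitSlots i₀ i₁ j)) →+* End (A₄ j)}
  {θ₄ : ∀ j, Kf (orbitSlots i₀ i₁ j) →+* Module.End ℂ (complexBetti (A₄ j).X 1)}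

/-- **A Weil part of a weight of `X = ⨁_j A₄(κ j)` has an algebraic line, GIVEN Markman's fourfold theorem**: the slot
projection `P` is injective on it with image the Weil weight `{(m+1, s) | s ∘ i = τ_b}` of `Y` (`IsWeil₃Part.image_eq`,
`toPt₃_injective`), whose line is algebraic (§2); seat b30's distribution lemma lifts this along `κ`.
[cite: Milne2020HodgeClassesAV, 1.2 (a) and Thm. 1] [cite: Markman2025SurveySecant, Thm. 1.2] -/
theorem weightClassesAlg_le_algebraicClasses_of_isWeil₃Part (hW4 : Markman2025_weilClasses_algebraic_abelianFourfold)
    (h8 : Module.finrank ℚ (Kf i₁) = 8) (h2 : Module.finrank ℚ (Kf i₀) = 2)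
    (hττ : ComplexEmbedding.conjugate τ ≠ τ) (hk : ∀ σ : Kf i₀ →+* ℂ, σ = τ ∨ σ = ComplexEmbedding.conjugate τ)
    (he_sign : ∀ s : Kf i₁ →+* ℂ, (e s).2 = true ↔ s.comp i = τ)
    (hA : ∀ j, IsCMTypeRealisation (Φ₄ j) (A₄ j) (ι₄ j) (θ₄ j))
    (hcount : ∀ (m : Fin 3) (τ' : Kf i₀ →+* ℂ),
      (Finset.univ.filter fun s : Kf i₁ →+* ℂ => s.comp i = τ' ∧ s ∈ (Φ₄ m.succ).1).card = 2)
    {m : Fin 3} {b : Bool} {G : Finset ((j : Fin N) × (Kf (orbitSlots i₀ i₁ (κ j)) →+* ℂ))}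
    (hG : IsWeil₃Part (fun x => toPt₃ e τ ((Sigma.map κ (fun _ => id) :
      ((j : Fin N) × (Kf (orbitSlots i₀ i₁ (κ j)) →+* ℂ)) → ((l : Fin 4) × (Kf (orbitSlots i₀ i₁ l) →+* ℂ))) x)) m b G) :
    G.card = 2 * 2 ∧ weightClassesAlg (fun j => A₄ (κ j)) (fun j => ι₄ (κ j)) (2 * 2) G ≤
      algebraicClasses (⨁ fun j => A₄ (κ j)).X 2 := by
  set P : ((j : Fin N) × (Kf (orbitSlots i₀ i₁ (κ j)) →+* ℂ)) → ((l : Fin 4) × (Kf (orbitSlots i₀ i₁ l) →+* ℂ)) :=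
    Sigma.map κ (fun _ => id) with hP
  have hinjv := hG.injOn
  have hPinj : Set.InjOn P ↑G := fun x hx x' hx' h => hinjv hx hx' (by change toPt₃ e τ (P x) = toPt₃ e τ (P x'); rw [h])
  have hq : G.card = 2 * 2 := by rw [hG.1]
  set τb : Kf i₀ →+* ℂ := if b then τ else ComplexEmbedding.conjugate τ with hτb
  -- the image of `G` under `P` is the Weil weight of `Y` in slot `m+1` over `τ_b`
  have hGim : (G.image P).image (toPt₃ e τ) =
      (Finset.univ : Finset (Fin 4)).image fun a => (Sum.inr (m, (a, b)) : Pt₃) := by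
    rw [Finset.image_image]; exact hG.image_eq
  have himg : G.image P = (Finset.univ.filter fun s : Kf i₁ →+* ℂ => s.comp i = τb).image fun s : Kf i₁ →+* ℂ =>
      (⟨m.succ, s⟩ : (l : Fin 4) × (Kf (orbitSlots i₀ i₁ l) →+* ℂ)) := by
    ext y
    constructor
    · intro hy
      have hty : toPt₃ e τ y ∈ (Finset.univ : Finset (Fin 4)).image fun a => (Sum.inr (m, (a, b)) : Pt₃) :=
        hGim ▸ Finset.mem_image_of_mem _ hy
      obtain ⟨a, -, ha⟩ := Finset.mem_image.1 hty
      rcases sigma_cases₃ y with ⟨σ, rfl⟩ | ⟨m', s, rfl⟩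
      · rw [toPt₃_zero] at ha
        exact absurd ha Sum.inr_ne_inl
      · rw [toPt₃_succ, Sum.inr.injEq, Prod.mk.injEq] at ha
        obtain ⟨rfl, ha⟩ := ha
        refine Finset.mem_image.2 ⟨s, Finset.mem_filter.2 ⟨Finset.mem_univ _, ?_⟩, rfl⟩
        exact (snd_eq_iff_comp_eq hk hττ he_sign b s).1 (by rw [← ha])
    · intro hy
      obtain ⟨s, hs, rfl⟩ := Finset.mem_image.1 hy
      have hsb : (e s).2 = b := (snd_eq_iff_comp_eq hk hττ he_sign b s).2 (Finset.mem_filter.1 hs).2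
      have hmem : (Sum.inr (m, e s) : Pt₃) ∈ (G.image P).image (toPt₃ e τ) := by
        rw [hGim]
        exact Finset.mem_image.2 ⟨(e s).1, Finset.mem_univ _, by rw [← hsb]⟩
      obtain ⟨y, hy', hty⟩ := Finset.mem_image.1 hmem
      have : y = ⟨m.succ, s⟩ := toPt₃_injective hττ hk (by rw [hty, toPt₃_succ])
      rwa [this] at hy'
  have hYalg := weightClassesAlg_weilWeight₄_le_algebraicClasses_of_markman i m hA hW4 h8 h2 (hcount m) τb
  rw [← himg] at hYalg
  exact ⟨hq, weightClassesAlg_comp_le_algebraicClasses_of_injOn (K := fun l => Kf (orbitSlots i₀ i₁ l)) hA κ hq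
    hPinj hYalg⟩

end Parts

end Summit.HodgeConjecture.CorCM.OcticWeilOrbit

end
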